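import Mathlib.Analysis.SpecialFunctions.Pow.Real
import Mathlib.Analysis.SpecialFunctions.Sqrt
import Mathlib.Analysis.Complex.Basic
import Summits.Ventures.DiscreteObjects.UnitDistance.MoserFieldF4
import HarnessLib

/-!
# The Moser ring embeds in `ℂ` compatibly with conjugation — honesty of the hypothesis `u·σ(u) = 1` in `MoserFieldF4.lean`

Framing (verbatim for the cell): lottery ticket; floor = certified bounds/negative ranges.

`MoserFieldF4.colorable_four_of_moserRing` 4-colours every graph whose vertices carry labels in the Moser ring
`B = ℤ[1/3][ζ₆, (1+√33)/2]` with `u·σ(u) = 1` along every edge.  This file shows that this algebraic hypothesis is the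
geometric one: the ring homomorphism `moserToComplex : B →+* ℂ` (`ζ₆ ↦ (1 + i√3)/2`, `δ ↦ (1 + √33)/2`, `x₂ ↦ 1/3`)
intertwines `σ` with complex conjugation (`moserToComplex_conj`), hence `u·σ(u) = 1` implies `|u| = 1` in `ℂ`
(`normSq_eq_one_of_mul_conj`): such graphs are genuine unit-distance graphs of the plane with vertices in
`ℚ(√3, √11)² ⊂ ℂ`, and they are all 4-colourable (`unitDistance_and_colorable_four_of_moserRing`).  Census file of the
(U) seat, pub-namedobj-udg-g2, `MOSER-FIELD.md`; nothing here is literature.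
-/

noncomputable section

namespace Summit.Ventures.DiscreteObjects.UnitDistance

open MvPolynomial Complex SimpleGraph

/-- Images of the generators in `ℂ`: `ζ₆ = (1 + i√3)/2`, `δ = (1 + √33)/2`, `1/3`. -/
def gensC : Fin 3 → ℂ := ![(1 + I * (Real.sqrt 3 : ℂ)) / 2, (1 + (Real.sqrt 33 : ℂ)) / 2, 1 / 3]

/-- The defining relations of the Moser ring hold in `ℂ` for these values (so the embedding is well defined). -/
theorem eval_moserRel_C (i : Fin 3) : eval₂Hom (Int.castRingHom ℂ) gensC (moserRel i) = 0 := by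
  have h3 : ((Real.sqrt 3 : ℝ) : ℂ) ^ 2 = 3 := by
    rw [← Complex.ofReal_pow, Real.sq_sqrt (by norm_num : (0:ℝ) ≤ 3)]; norm_num
  have h33 : ((Real.sqrt 33 : ℝ) : ℂ) ^ 2 = 33 := by
    rw [← Complex.ofReal_pow, Real.sq_sqrt (by norm_num : (0:ℝ) ≤ 33)]; norm_num
  fin_cases i
  · simp [moserRel, gensC]
    linear_combination ((Real.sqrt 3 : ℂ) ^ 2 / 4) * Complex.I_sq + (-1 / 4 : ℂ) * h3
  · simp [moserRel, gensC]
    linear_combination (1 / 4 : ℂ) * h33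
  · simp [moserRel, gensC]

/-- The complex embedding of the Moser ring. -/
def moserToComplex : MoserRing →+* ℂ :=
  Ideal.Quotient.lift moserIdeal (eval₂Hom (Int.castRingHom ℂ) gensC) (by
    intro a ha
    refine (Ideal.span_le (I := RingHom.ker (eval₂Hom (Int.castRingHom ℂ) gensC))).2 ?_ ha
    rintro _ ⟨i, rfl⟩
    exact eval_moserRel_C i)

/-- The embedding on generators. -/
theorem moserToComplex_mgen (i : Fin 3) : moserToComplex (mgen i) = gensC i := by
  simp [moserToComplex, mgen]

/-- The conjugation `σ` on generators. -/
theorem moserConj_mgen (i : Fin 3) : moserConj (mgen i) = gensConj i := by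
  simp [moserConj, mgen]

/-- Compatibility: the embedding intertwines `σ` with complex conjugation. -/
theorem moserToComplex_conj (x : MoserRing) : moserToComplex (moserConj x) = starRingEnd ℂ (moserToComplex x) := by
  -- both sides are ring homs MoserRing → ℂ; compare on generators
  suffices h : (moserToComplex.comp moserConj).comp (Ideal.Quotient.mk moserIdeal) =
      ((starRingEnd ℂ).comp moserToComplex).comp (Ideal.Quotient.mk moserIdeal) by
    have := Ideal.Quotient.ringHom_ext h
    simpa using congrArg (fun f : MoserRing →+* ℂ => f x) this
  apply MvPolynomial.ringHom_ext
  · intro r; simp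
  · intro i
    have e1 : (Ideal.Quotient.mk moserIdeal) (X i) = mgen i := rfl
    simp only [RingHom.comp_apply, e1, moserConj_mgen, moserToComplex_mgen]
    fin_cases i
    · simp [gensConj, gensC, map_sub, map_one, moserToComplex_mgen, Complex.conj_ofReal, map_ofNat, Complex.ext_iff]
      constructor <;> ring
    · simp [gensConj, gensC, moserToComplex_mgen, Complex.conj_ofReal, map_ofNat]
    · simp [gensConj, gensC, moserToComplex_mgen, map_ofNat]

/-- Honesty: if `u·σ(u) = 1` in the Moser ring then the complex number `u` has norm `1` (so `B`-labelled graphs with this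
edge condition are genuine unit-distance graphs in the plane). -/
theorem normSq_eq_one_of_mul_conj {u : MoserRing} (hu : u * moserConj u = 1) : Complex.normSq (moserToComplex u) = 1 := by
  have h := congrArg moserToComplex hu
  rw [map_mul, map_one, moserToComplex_conj, Complex.mul_conj] at h
  exact_mod_cast h


/-- SUMMARY THEOREM.  A graph with Moser-ring labels `p` and `(p v − p w)·σ(p v − p w) = 1` on every edge is (i) realised
by `v ↦ moserToComplex (p v)` with every edge of Euclidean length `1` (norm-squared `1`), and (ii) 4-colourable. -/
theorem unitDistance_and_colorable_four_of_moserRing {V : Type*} {G : SimpleGraph V} (p : V → MoserRing)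
    (hadj : ∀ ⦃v w : V⦄, G.Adj v w → (p v - p w) * moserConj (p v - p w) = 1) :
    (∀ ⦃v w : V⦄, G.Adj v w → Complex.normSq (moserToComplex (p v) - moserToComplex (p w)) = 1) ∧ G.Colorable 4 := by
  refine ⟨fun v w h => ?_, colorable_four_of_moserRing p hadj⟩
  rw [← map_sub]
  exact normSq_eq_one_of_mul_conj (hadj h)

end Summit.Ventures.DiscreteObjects.UnitDistance

end
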